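import Summits.Ventures.PercRepro.C041TriDomExcessZeroSide

/-!
# ROW C-041 — THE EQUALITY CASE OF THE EXCESS, IV: THE TRIANGLE STATUS AND ITS PATTERNS (p6, gen 43; §53 ADDENDUM 2)

Towards the first base case of the converse of THEOREM (SEPARABLE ⟹ THE EXCESS VANISHES) — a host whose three
(distinct) marks are pairwise joined by edges `f₁ = a₁u`, `f₂ = a₁u'`, `f₃ = uu'` has excess `≥ 1`
(`excess_ge_one_of_triangle`, part V `C041TriDomExcessTriangle`).  Here: THE TRIANGLE STATUS `triSt f₁ f₂ f₃` (the
three edges free, every other edge absent); the connectivity between two of the three vertices of a three-edge graph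
through the edges satisfying a predicate is `e₁ ∨ (e₂ ∧ e₃)` (`reach_three_iff`, an invariant of the
reflexive–transitive closure); so the red pattern is `triPat (p, q, r) = (p ∨ q∧r, q ∨ p∧r, r ∨ p∧q)` in the three
colours of the edges and the blue pattern `triPat` of their negations (`rsig_tri`, `bsig_tri`); the contribution of a
colouring is `triG (p, q, r)`, non-negative and equal to `1` at all-red and all-blue (`triG_nonneg`, `triG_ttt`,
`triG_fff`, three `decide`s).
-/

namespace PercRepro

namespace ZoneZ

namespace MultiExit

open ZoneData Finset

variable {V₁ E₁ U₁ U₂ : Type} (Z₁ : ZoneData V₁ E₁ U₁ U₂) (u u' a₁ : V₁)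

/-! ## Connectivity in a three-edge graph -/

omit Z₁ in
/-- An edge joining `a` and `b` and joining `v` and `w` has `{v, w} = {a, b}`. -/
theorem joins_unique {Z : ZoneData V₁ E₁ U₁ U₂} {e : E₁} {a b v w : V₁} (h1 : Z.Joins e a b) (h2 : Z.Joins e v w) :
    (v = a ∧ w = b) ∨ (v = b ∧ w = a) := by
  unfold ZoneData.Joins at h1 h2
  rcases h1 with ⟨ha, hb⟩ | ⟨ha, hb⟩ <;> rcases h2 with ⟨hv, hw⟩ | ⟨hv, hw⟩
  · exact Or.inl ⟨hv.symm.trans ha, hw.symm.trans hb⟩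
  · exact Or.inr ⟨hw.symm.trans hb, hv.symm.trans ha⟩
  · exact Or.inr ⟨hv.symm.trans ha, hw.symm.trans hb⟩
  · exact Or.inl ⟨hw.symm.trans hb, hv.symm.trans ha⟩

/-- Adjacency through the edges `e₁, e₂, e₃` satisfying `P`. -/
def Adj3 (e₁ e₂ e₃ : E₁) (P : E₁ → Prop) : V₁ → V₁ → Prop :=
  AdjCol Z₁ fun e => (e = e₁ ∨ e = e₂ ∨ e = e₃) ∧ P e

/-- In the three-edge graph `e₁ = ab`, `e₂ = ac`, `e₃ = bc` (distinct vertices), `b` is reached from `a` through the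
edges satisfying `P` iff `P e₁` or (`P e₂` and `P e₃`). -/
theorem reach_three_iff {a b c : V₁} {e₁ e₂ e₃ : E₁} (hab : a ≠ b) (hac : a ≠ c) (hbc : b ≠ c)
    (h1 : Z₁.Joins e₁ a b) (h2 : Z₁.Joins e₂ a c) (h3 : Z₁.Joins e₃ b c) (P : E₁ → Prop) :
    Relation.ReflTransGen (Adj3 Z₁ e₁ e₂ e₃ P) a b ↔ (P e₁ ∨ (P e₂ ∧ P e₃)) := by
  constructor
  · intro h
    -- the invariant of the closure
    have key : ∀ v, Relation.ReflTransGen (Adj3 Z₁ e₁ e₂ e₃ P) a v →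
        v = a ∨ (v = b ∧ (P e₁ ∨ (P e₂ ∧ P e₃))) ∨ (v = c ∧ (P e₂ ∨ (P e₁ ∧ P e₃))) := by
      intro v hv
      induction hv with
      | refl => exact Or.inl rfl
      | @tail w v _ hwv ih =>
        obtain ⟨e, hj, he, hP⟩ := hwv
        rcases he with rfl | rfl | rfl
        · -- the edge `ab`
          rcases joins_unique h1 hj with ⟨hw, hv⟩ | ⟨hw, hv⟩
          · exact Or.inr (Or.inl ⟨hv, Or.inl hP⟩)
          · exact Or.inl hv
        · -- the edge `ac`
          rcases joins_unique h2 hj with ⟨hw, hv⟩ | ⟨hw, hv⟩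
          · exact Or.inr (Or.inr ⟨hv, Or.inl hP⟩)
          · exact Or.inl hv
        · -- the edge `bc`
          rcases joins_unique h3 hj with ⟨hw, hv⟩ | ⟨hw, hv⟩
          · -- from `b` to `c`
            subst hw
            rcases ih with hb | ⟨_, hb⟩ | ⟨hb, _⟩
            · exact absurd hb hab.symm
            · refine Or.inr (Or.inr ⟨hv, ?_⟩)
              rcases hb with hp | ⟨hq, _⟩
              · exact Or.inr ⟨hp, hP⟩
              · exact Or.inl hq
            · exact absurd hb hbc
          · -- from `c` to `b`
            subst hw
            rcases ih with hc | ⟨hc, _⟩ | ⟨_, hc⟩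
            · exact absurd hc hac.symm
            · exact absurd hc hbc.symm
            · refine Or.inr (Or.inl ⟨hv, ?_⟩)
              rcases hc with hq | ⟨hp, _⟩
              · exact Or.inr ⟨hq, hP⟩
              · exact Or.inl hp
    rcases key b h with hb | ⟨_, hb⟩ | ⟨hb, _⟩
    · exact absurd hb hab.symm
    · exact hb
    · exact absurd hb hbc
  · rintro (hp | ⟨hq, hr⟩)
    · exact Relation.ReflTransGen.single ⟨e₁, h1, Or.inl rfl, hp⟩
    · exact (Relation.ReflTransGen.single ⟨e₂, h2, Or.inr (Or.inl rfl), hq⟩).tail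
        ⟨e₃, Joins_symm Z₁ h3, Or.inr (Or.inr rfl), hr⟩

/-! ## The triangle status -/

variable [DecidableEq E₁]

/-- The triangle status: the edges `f₁, f₂, f₃` free, every other edge absent. -/
def triSt (f₁ f₂ f₃ : E₁) : E₁ → EStat := fun e => if e = f₁ ∨ e = f₂ ∨ e = f₃ then .free else .absent

/-- Red edges of the triangle status. -/
theorem redE_triSt (f₁ f₂ f₃ : E₁) (ω : E₁ → Bool) (e : E₁) :
    redE (triSt f₁ f₂ f₃) ω e ↔ ((e = f₁ ∨ e = f₂ ∨ e = f₃) ∧ ω e = true) := by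
  unfold redE triSt
  by_cases h : e = f₁ ∨ e = f₂ ∨ e = f₃ <;> simp [h]

/-- Blue edges of the triangle status. -/
theorem blueE_triSt (f₁ f₂ f₃ : E₁) (ω : E₁ → Bool) (e : E₁) :
    blueE (triSt f₁ f₂ f₃) ω e ↔ ((e = f₁ ∨ e = f₂ ∨ e = f₃) ∧ ω e = false) := by
  unfold blueE triSt
  by_cases h : e = f₁ ∨ e = f₂ ∨ e = f₃ <;> simp [h]

/-- The red adjacency of the triangle status is the adjacency through the red triangle edges. -/
theorem RAdjS_triSt (f₁ f₂ f₃ : E₁) (ω : E₁ → Bool) :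
    RAdjS Z₁ (triSt f₁ f₂ f₃) ω = Adj3 Z₁ f₁ f₂ f₃ fun e => ω e = true := by
  funext x y
  exact propext (exists_congr fun e => and_congr_right fun _ => redE_triSt f₁ f₂ f₃ ω e)

/-- The blue adjacency of the triangle status is the adjacency through the blue triangle edges. -/
theorem BAdjS_triSt (f₁ f₂ f₃ : E₁) (ω : E₁ → Bool) :
    BAdjS Z₁ (triSt f₁ f₂ f₃) ω = Adj3 Z₁ f₁ f₂ f₃ fun e => ω e = false := by
  funext x y
  exact propext (exists_congr fun e => and_congr_right fun _ => blueE_triSt f₁ f₂ f₃ ω e)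

/-- Red connectivity in the triangle status, from `a` to `b` through `e₁ = ab`, `e₂ = ac`, `e₃ = bc`. -/
theorem RdS_triSt_iff {a b c : V₁} {f₁ f₂ f₃ : E₁} (hab : a ≠ b) (hac : a ≠ c) (hbc : b ≠ c)
    (h1 : Z₁.Joins f₁ a b) (h2 : Z₁.Joins f₂ a c) (h3 : Z₁.Joins f₃ b c) (ω : E₁ → Bool) :
    RdS Z₁ (triSt f₁ f₂ f₃) ω a b ↔ (ω f₁ = true ∨ (ω f₂ = true ∧ ω f₃ = true)) := by
  unfold RdS
  rw [mem_reach_singleton, RAdjS_triSt]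
  exact reach_three_iff Z₁ hab hac hbc h1 h2 h3 _

/-- Blue connectivity in the triangle status. -/
theorem MgS_triSt_iff {a b c : V₁} {f₁ f₂ f₃ : E₁} (hab : a ≠ b) (hac : a ≠ c) (hbc : b ≠ c)
    (h1 : Z₁.Joins f₁ a b) (h2 : Z₁.Joins f₂ a c) (h3 : Z₁.Joins f₃ b c) (ω : E₁ → Bool) :
    MgS Z₁ (triSt f₁ f₂ f₃) ω a b ↔ (ω f₁ = false ∨ (ω f₂ = false ∧ ω f₃ = false)) := by
  unfold MgS
  rw [mem_reach_singleton, BAdjS_triSt]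
  exact reach_three_iff Z₁ hab hac hbc h1 h2 h3 _

/-- The triangle status is symmetric in the order of its edges (second and third). -/
theorem triSt_perm (f₁ f₂ f₃ : E₁) : triSt f₁ f₂ f₃ = triSt f₂ f₁ f₃ := by
  funext e; unfold triSt
  by_cases h1 : e = f₁ <;> by_cases h2 : e = f₂ <;> simp [h1, h2]

/-- The triangle status is symmetric in the order of its edges (a rotation). -/
theorem triSt_rot (f₁ f₂ f₃ : E₁) : triSt f₁ f₂ f₃ = triSt f₃ f₁ f₂ := by
  funext e; unfold triSt
  by_cases h1 : e = f₁ <;> by_cases h2 : e = f₂ <;> by_cases h3 : e = f₃ <;> simp [h1, h2, h3]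

/-- A decision as a Boolean expression. -/
theorem decide_eq_of_iff {P : Prop} [Decidable P] {b : Bool} (h : P ↔ b = true) : decide P = b := by
  cases b
  · exact decide_eq_false (fun hp => Bool.false_ne_true (h.1 hp))
  · exact decide_eq_true (h.2 rfl)

/-- The triangle's pattern as a function of three Booleans. -/
def triPat (p q r : Bool) : P3 := (p || (q && r), q || (p && r), r || (p && q))

open Classical in
/-- THE RED PATTERN OF THE TRIANGLE. -/
theorem rsig_tri {f₁ f₂ f₃ : E₁} (hau : a₁ ≠ u) (hau' : a₁ ≠ u') (huu' : u ≠ u') (h1 : Z₁.Joins f₁ a₁ u)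
    (h2 : Z₁.Joins f₂ a₁ u') (h3 : Z₁.Joins f₃ u u') (ω : E₁ → Bool) :
    rsig Z₁ u u' a₁ (triSt f₁ f₂ f₃) ω = triPat (ω f₁) (ω f₂) (ω f₃) := by
  have e1 := RdS_triSt_iff Z₁ hau hau' huu' h1 h2 h3 ω
  have e2 := RdS_triSt_iff Z₁ hau' hau huu'.symm h2 h1 (Joins_symm Z₁ h3) ω
  have e3 := RdS_triSt_iff Z₁ huu' hau.symm hau'.symm h3 (Joins_symm Z₁ h1) (Joins_symm Z₁ h2) ω
  rw [triSt_perm] at e2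
  rw [← triSt_rot f₁ f₂ f₃] at e3
  unfold rsig triPat
  refine Prod.ext (decide_eq_of_iff ?_) (Prod.ext (decide_eq_of_iff ?_) (decide_eq_of_iff ?_))
  · rw [e1]; simp
  · rw [e2]; simp
  · rw [e3]; simp

open Classical in
/-- THE BLUE PATTERN OF THE TRIANGLE. -/
theorem bsig_tri {f₁ f₂ f₃ : E₁} (hau : a₁ ≠ u) (hau' : a₁ ≠ u') (huu' : u ≠ u') (h1 : Z₁.Joins f₁ a₁ u)
    (h2 : Z₁.Joins f₂ a₁ u') (h3 : Z₁.Joins f₃ u u') (ω : E₁ → Bool) :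
    bsig Z₁ u u' a₁ (triSt f₁ f₂ f₃) ω = triPat (!ω f₁) (!ω f₂) (!ω f₃) := by
  have e1 := MgS_triSt_iff Z₁ hau hau' huu' h1 h2 h3 ω
  have e2 := MgS_triSt_iff Z₁ hau' hau huu'.symm h2 h1 (Joins_symm Z₁ h3) ω
  have e3 := MgS_triSt_iff Z₁ huu' hau.symm hau'.symm h3 (Joins_symm Z₁ h1) (Joins_symm Z₁ h2) ω
  rw [triSt_perm] at e2
  rw [← triSt_rot f₁ f₂ f₃] at e3
  unfold bsig triPat
  refine Prod.ext (decide_eq_of_iff ?_) (Prod.ext (decide_eq_of_iff ?_) (decide_eq_of_iff ?_))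
  · rw [e1]; simp
  · rw [e2]; simp
  · rw [e3]; simp

/-- The contribution of a colouring of the triangle. -/
def triG (b : Bool × Bool × Bool) : ℤ := Fsym (triPat b.1 b.2.1 b.2.2) (triPat (!b.1) (!b.2.1) (!b.2.2))

/-- The triangle never shows a crossed pair. -/
theorem triG_nonneg : ∀ b : Bool × Bool × Bool, 0 ≤ triG b := by decide

/-- All red: `(⊤, ⊥)`. -/
theorem triG_ttt : triG (true, true, true) = 1 := by decide

/-- All blue: `(⊥, ⊤)`. -/
theorem triG_fff : triG (false, false, false) = 1 := by decide

end MultiExit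

end ZoneZ

end PercRepro
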